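import Summits.ValiantsHypothesis.ValiantsHypothesis.Theorems.SymPencilPerFourHessianToric
import Summits.ValiantsHypothesis.ValiantsHypothesis.Theorems.SymPencilPerFourBlocksThree

/-!
# Route `SymPencil` — the `(10, 6)` cell: a rank-`3` row with a zero cell at dimension `6`
# forces two rows or a cross (Case B3 of the residual `R6` of
# `Cruxes/SdcSuperquadratic/NEXT-RUNG-25.md`; `--supports` stmt-ValiantsHypothesis-5674)

Setting (val-width-5674-p2's Case B3, `SymPencilPerFourHessianRankThreeZero`): H3, the swapped
property with `< 6` squares, a cell `(a, m₁) ≡ 0` while row `a` realises every `v` with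
`v_{m₁} = 0`; p2 proved `dim W ≤ 6`.  **Theorem** (`rows_or_cross_of_zero_cell_six`): if
`dim W = 6` then `W` lies in two rows `a, b` or in a cross `X_{a c₀}`.  Proof: p2 gives column
`m₁ ≡ 0` and all `2 × 2` subpermanents vanishing on `W₀ = W ∩ {row a = 0}` (dimension `3`), so
`W₀` is a row `b` or a column `c₀` (`SymPencilPerFourBlocksThree`, val-width-5674-p3 g0) and `W`
contains the units `E_{bk}` (`k ≠ m₁`) resp. `E_{b c₀}` (`b ≠ a`), each killing the complementary
`2 × 2` subpermanents (`SymPencilPerFourHessianToric.perm_two_of_unit`).  Row case: the forms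
`x_{aj} x_{cl} + x_{al} x_{cj}` (`c ∉ {a, b}`) evaluated at the elements `z^j` (row `a = e_j`) and
their sums give `z^j_{cl} = 0`, `θ_j + θ_k = 0` (`θ_j = z^j_{cj}`), hence `θ ≡ 0` and, polarising,
`x_{cj} ≡ 0`.  Column case: `x_{a m'} x_{d m''} + x_{a m''} x_{d m'} ≡ 0` (`{m', m''} = {m₁, c₀}ᶜ`);
the COLUMN minors (`SymPencilPerFourHessianColControl`) for `(c₀, m')` and row `d`, at `z'` and
`z' + E_{c c₀}`, give `z'_{d m'} = 0` — this is where the exotic `6`-space of the note (H3 + row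
minors, not in a cross) dies — and polarising gives `x_{d m'} = x_{d m''} = 0`.  The two outcomes
are killed by the bricks of `SymPencilPerFourSixDimDetecting` / `…SixDimCross` (assembled
elsewhere).  Honest framing: one of three cases (B2 landed, toric open) of `R6` / `H106`;
`sdc(per_4) ≥ 25` is the tree's value; the crux `SdcSuperquadratic` and `VP ≠ VNP` are untouched.
No definitions, no named facts. [folklore]
-/

noncomputable section

-- single-conjunct layout: Sub = Summit, duplicated namespace component intended
set_option linter.dupNamespace false

namespace Summit.ValiantsHypothesis.ValiantsHypothesis.Theorems.SymPencilPerFourSixDimZeroCellSix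

open Matrix MvPolynomial Finset Module
open Literature.Computability.AlgebraicComplexity
open Literature.Computability.AlgebraicComplexity.AlperBogartVelasco
open Summit.ValiantsHypothesis.ValiantsHypothesis.Theorems.SymPencilPerFourHessianMinors
open Summit.ValiantsHypothesis.ValiantsHypothesis.Theorems.SymPencilPerFourHessianRowControl
open Summit.ValiantsHypothesis.ValiantsHypothesis.Theorems.SymPencilPerFourHessianColControl
open Summit.ValiantsHypothesis.ValiantsHypothesis.Theorems.SymPencilPerFourHessianRankThreeProp
open Summit.ValiantsHypothesis.ValiantsHypothesis.Theorems.SymPencilPerFourHessianRankThreeZero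
open Summit.ValiantsHypothesis.ValiantsHypothesis.Theorems.SymPencilPerFourHessianToric
open Summit.ValiantsHypothesis.ValiantsHypothesis.Theorems.SymPencilPerFourBlocksThree

variable {K : Type*} [Field K]

set_option maxHeartbeats 800000 in
/-- **Case B3 at dimension `6`: two rows or a cross.**  See the module docstring. [folklore] -/
theorem rows_or_cross_of_zero_cell_six [CharZero K] {ι : Type*} [Fintype ι]
    (hι : Fintype.card ι < 6) (W : Submodule K (Fin 4 × Fin 4 → K))
    (hW3 : ∀ x ∈ W, ∀ (r c : Fin 3 → Fin 4), Function.Injective r → Function.Injective c →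
      ((Matrix.of fun i j => x (i, j)).submatrix r c).permanent = 0)
    (hW : ∀ y ∈ W, ∃ (c : ι → K) (Λ : ι → ((Fin 4 × Fin 4 → K) →ₗ[K] K)),
      ∀ u : Fin 4 × Fin 4 → K, ∃ e₀ e₁ : K, ∀ s : K,
        eval (u + s • y) (perPoly (Fin 4) K) = e₀ + s * e₁ + s ^ 2 * ∑ k, c k * (Λ k u) ^ 2)
    (a m₁ : Fin 4) (hzero : ∀ x ∈ W, x (a, m₁) = 0)
    (hreal : ∀ v : Fin 4 → K, v m₁ = 0 → ∃ z ∈ W, ∀ j, z (a, j) = v j)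
    (h6 : finrank K W = 6) :
    (∃ b : Fin 4, b ≠ a ∧ ∀ x ∈ W, ∀ i j : Fin 4, i ≠ a → i ≠ b → x (i, j) = 0) ∨
    (∃ c₀ : Fin 4, ∀ x ∈ W, ∀ i j : Fin 4, i ≠ a → j ≠ c₀ → x (i, j) = 0) := by
  classical
  -- (0) unit rows `e_j` in row `a`, `j ≠ m₁`
  have hunit : ∀ j, j ≠ m₁ → ∃ z ∈ W, ∀ j', z (a, j') = (Pi.single j (1 : K) : Fin 4 → K) j' :=
    fun j hj => hreal (Pi.single j 1) (Pi.single_eq_of_ne (Ne.symm hj) _)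
  -- (1) the column `m₁` vanishes on `W` (p2)
  have hcol : ∀ x ∈ W, ∀ b, x (b, m₁) = 0 := by
    intro x hx b
    by_cases hba : b = a
    · rw [hba]; exact hzero x hx
    obtain ⟨c, hcm, hq⟩ := exists_perm_col_vanish_of_sum_sq_swap hι W hW a b m₁ (Ne.symm hba)
    have hprod : ∀ y ∈ W, y (a, c) * y (b, m₁) = 0 := fun y hy => by
      have h := hq y hy
      rwa [hzero y hy, zero_mul, add_zero] at h
    rcases forall_eq_zero_or_of_mul₂ W (linePoly_cell (a, c)) (linePoly_cell (b, m₁)) hprod with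
      h | h
    · obtain ⟨z, hz, hzv⟩ := hunit c hcm
      have := h z hz
      rw [hzv, Pi.single_eq_same] at this
      exact absurd this one_ne_zero
    · exact h x hx
  -- (2) on `W₀`: all `2 × 2` subpermanents of rows `≠ a` vanish (p2)
  have hperm : ∀ x ∈ W, (∀ j, x (a, j) = 0) → ∀ b c : Fin 4, b ≠ a → c ≠ a → b ≠ c →
      ∀ j l : Fin 4, j ≠ l → x (b, j) * x (c, l) + x (b, l) * x (c, j) = 0 := by
    intro x hx hxa b c hba hca hbc j l hjl
    by_cases hjm : j = m₁
    · rw [hjm, hcol x hx c, hcol x hx b, mul_zero, zero_mul, add_zero]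
    by_cases hlm : l = m₁
    · rw [hlm, hcol x hx c, hcol x hx b, mul_zero, zero_mul, add_zero]
    obtain ⟨k, hkm, hkj, hkl⟩ := exists_fourth m₁ j l
    obtain ⟨z, hz, hzv⟩ := hunit k hkm
    have hzk : z (a, k) = 1 := by rw [hzv, Pi.single_eq_same]
    have hzj : z (a, j) = 0 := by rw [hzv, Pi.single_eq_of_ne (Ne.symm hkj)]
    have hzl : z (a, l) = 0 := by rw [hzv, Pi.single_eq_of_ne (Ne.symm hkl)]
    have hinjr : Function.Injective ![a, b, c] := injective_vec_three hba.symm hca.symm hbc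
    have hinjc : Function.Injective ![k, j, l] := injective_vec_three hkj hkl hjl
    have P : ∀ t : K, (z (b, j) + t * x (b, j)) * (z (c, l) + t * x (c, l)) +
        (z (b, l) + t * x (b, l)) * (z (c, j) + t * x (c, j)) = 0 := by
      intro t
      have h := hW3 (z + t • x) (W.add_mem hz (W.smul_mem t hx)) ![a, b, c] ![k, j, l] hinjr hinjc
      rw [Matrix.permanent_fin_three_row] at h
      simp only [Matrix.submatrix_apply, Matrix.of_apply, Matrix.cons_val_zero, Matrix.cons_val_one,
        Matrix.cons_val, Pi.add_apply, Pi.smul_apply, smul_eq_mul, hzk, hzj, hzl, hxa,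
        mul_zero, add_zero, one_mul, zero_mul] at h
      linear_combination h
    have h0 := P 0
    have h1 := P 1
    have h2 := P (-1)
    have h3 : (2 : K) * (x (b, j) * x (c, l) + x (b, l) * x (c, j)) = 0 := by
      linear_combination h1 + h2 - 2 * h0
    exact (mul_eq_zero.1 h3).resolve_left two_ne_zero
  -- (3) `W₀ = W ∩ {row a = 0}` has dimension `3`
  let ρ : (Fin 4 × Fin 4 → K) →ₗ[K] (Fin 4 → K) := LinearMap.funLeft K K fun j : Fin 4 => (a, j)
  have hρ : ∀ x j, ρ x j = x (a, j) := fun _ _ => rfl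
  set W₀ : Submodule K (Fin 4 × Fin 4 → K) := W ⊓ LinearMap.ker ρ with hW₀
  have memW₀ : ∀ x, x ∈ W₀ ↔ x ∈ W ∧ ∀ j, x (a, j) = 0 := fun x => by
    rw [hW₀, Submodule.mem_inf, LinearMap.mem_ker]
    exact ⟨fun h => ⟨h.1, fun j => by have := congr_fun h.2 j; rwa [hρ] at this⟩,
      fun h => ⟨h.1, funext fun j => h.2 j⟩⟩
  have hk3 : finrank K (LinearMap.ker (LinearMap.proj m₁ : (Fin 4 → K) →ₗ[K] K)) = 3 := by
    have hsurj : Function.Surjective (LinearMap.proj m₁ : (Fin 4 → K) →ₗ[K] K) :=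
      fun t => ⟨Pi.single m₁ t, by simp⟩
    have h := LinearMap.finrank_range_add_finrank_ker (LinearMap.proj m₁ : (Fin 4 → K) →ₗ[K] K)
    rw [LinearMap.range_eq_top.2 hsurj, finrank_top, Module.finrank_self,
      Module.finrank_fintype_fun_eq_card, Fintype.card_fin] at h
    omega
  have himage : W.map ρ = LinearMap.ker (LinearMap.proj m₁ : (Fin 4 → K) →ₗ[K] K) := by
    apply le_antisymm
    · rintro _ ⟨x, hx, rfl⟩
      rw [LinearMap.mem_ker, LinearMap.proj_apply, hρ]
      exact hzero x hx
    · intro v hv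
      rw [LinearMap.mem_ker, LinearMap.proj_apply] at hv
      obtain ⟨z, hz, hzv⟩ := hreal v hv
      exact ⟨z, hz, funext fun j => by rw [hρ, hzv]⟩
  have hW₀3 : finrank K W₀ = 3 := by
    have hdim := finrank_eq_finrank_map_add_finrank_inf_ker W ρ
    rw [← hW₀, himage, hk3, h6] at hdim
    omega
  have W₀W : ∀ x ∈ W₀, x ∈ W := fun x hx => ((memW₀ x).1 hx).1
  have W₀a : ∀ x ∈ W₀, ∀ j, x (a, j) = 0 := fun x hx => ((memW₀ x).1 hx).2
  -- (4) all `2 × 2` subpermanents vanish on `W₀`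
  have hB : ∀ y ∈ W₀, ∀ i k j l : Fin 4, i ≠ k → j ≠ l →
      y (i, j) * y (k, l) + y (i, l) * y (k, j) = 0 := by
    intro y hy i k j l hik hjl
    by_cases hi : i = a
    · rw [hi, W₀a y hy, W₀a y hy, zero_mul, zero_mul, add_zero]
    by_cases hk : k = a
    · rw [hk, W₀a y hy, W₀a y hy, mul_zero, mul_zero, add_zero]
    exact hperm y (W₀W y hy) (W₀a y hy) i k hi hk hik j l hjl
  -- (5) `W₀` lies in one row or one column
  rcases row_or_col_of_perm_two_blocks_three W₀ hB hW₀3 with ⟨q, hq⟩ | ⟨c₀, hc₀⟩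
  · -- ROW CASE
    -- `q ≠ a`
    have hqa : q ≠ a := by
      intro hqa
      have hbot : W₀ = ⊥ := by
        rw [Submodule.eq_bot_iff]
        intro x hx
        funext p
        obtain ⟨i, j⟩ := p
        by_cases hi : i = a
        · rw [hi]; exact W₀a x hx j
        · exact hq x hx i j (by rw [hqa]; exact hi)
      rw [hbot, finrank_bot] at hW₀3
      exact absurd hW₀3 (by norm_num)
    -- units `E_{qk} ∈ W` for `k ≠ m₁`
    have hunitq : ∀ k, k ≠ m₁ → (Pi.single (q, k) (1 : K) : Fin 4 × Fin 4 → K) ∈ W := by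
      intro k hkm
      let γ : (Fin 4 × Fin 4 → K) →ₗ[K] (Fin 4 → K) := LinearMap.funLeft K K fun j : Fin 4 => (q, j)
      have hγ : ∀ x j, γ x j = x (q, j) := fun _ _ => rfl
      have hker : LinearMap.ker (γ.domRestrict W₀) = ⊥ := by
        rw [Submodule.eq_bot_iff]
        intro x hx
        rw [LinearMap.mem_ker, LinearMap.domRestrict_apply] at hx
        apply Subtype.ext
        funext p
        obtain ⟨i, j⟩ := p
        change (x : Fin 4 × Fin 4 → K) (i, j) = 0
        by_cases hi : i = q
        · rw [hi]; have := congr_fun hx j; rwa [hγ] at this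
        · exact hq x x.2 i j hi
      have hrange : LinearMap.range (γ.domRestrict W₀) =
          LinearMap.ker (LinearMap.proj m₁ : (Fin 4 → K) →ₗ[K] K) := by
        apply Submodule.eq_of_le_of_finrank_le
        · rintro _ ⟨x, rfl⟩
          rw [LinearMap.mem_ker, LinearMap.proj_apply, LinearMap.domRestrict_apply, hγ]
          exact hcol x (W₀W x x.2) q
        · have := LinearMap.finrank_range_add_finrank_ker (γ.domRestrict W₀)
          rw [hker, finrank_bot, add_zero] at this
          rw [hk3, this, hW₀3]
      have hmem : (Pi.single k (1 : K) : Fin 4 → K) ∈ LinearMap.range (γ.domRestrict W₀) := by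
        rw [hrange, LinearMap.mem_ker, LinearMap.proj_apply]
        exact Pi.single_eq_of_ne (Ne.symm hkm) _
      obtain ⟨x, hx⟩ := hmem
      have hxE : (x : Fin 4 × Fin 4 → K) = Pi.single (q, k) 1 := by
        funext p
        obtain ⟨i, j⟩ := p
        by_cases hi : i = q
        · subst hi
          have := congr_fun hx j
          rw [LinearMap.domRestrict_apply, hγ] at this
          rw [this]
          by_cases hj : j = k
          · subst hj; simp
          · rw [Pi.single_eq_of_ne hj, Pi.single_eq_of_ne (fun h => hj (Prod.mk.inj h).2)]
        · rw [hq x x.2 i j hi, Pi.single_eq_of_ne (fun h => hi (Prod.mk.inj h).1)]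
      rw [← hxE]
      exact W₀W x x.2
    refine Or.inl ⟨q, hqa, fun x hx i j hia hiq => ?_⟩
    by_cases hjm : j = m₁
    · rw [hjm]; exact hcol x hx i
    -- the two other columns `k, l`
    obtain ⟨k, l, hkl, hkm, hkj, hlm, hlj, -⟩ := exists_other_two m₁ j (Ne.symm hjm)
    -- the quadratic identities from the units `E_{qk}, E_{ql}, E_{qj}`
    have Qk : ∀ y ∈ W, y (a, j) * y (i, l) + y (a, l) * y (i, j) = 0 := fun y hy =>
      perm_two_of_unit W hW3 (hunitq k hkm) hqa.symm hiq hia.symm hkj.symm hkl.symm hlj.symm hy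
    have Ql : ∀ y ∈ W, y (a, j) * y (i, k) + y (a, k) * y (i, j) = 0 := fun y hy =>
      perm_two_of_unit W hW3 (hunitq l hlm) hqa.symm hiq hia.symm hlj.symm hkl hkj.symm hy
    have Qj : ∀ y ∈ W, y (a, k) * y (i, l) + y (a, l) * y (i, k) = 0 := fun y hy =>
      perm_two_of_unit W hW3 (hunitq j hjm) hqa.symm hiq hia.symm hkj hlj hkl hy
    -- the elements `z^j, z^k, z^l`
    obtain ⟨zj, hzj, hzjv⟩ := hunit j hjm
    obtain ⟨zk, hzk, hzkv⟩ := hunit k hkm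
    obtain ⟨zl, hzl, hzlv⟩ := hunit l hlm
    have zjj : zj (a, j) = 1 := by rw [hzjv, Pi.single_eq_same]
    have zjk : zj (a, k) = 0 := by rw [hzjv, Pi.single_eq_of_ne hkj]
    have zjl : zj (a, l) = 0 := by rw [hzjv, Pi.single_eq_of_ne hlj]
    have zkk : zk (a, k) = 1 := by rw [hzkv, Pi.single_eq_same]
    have zkj : zk (a, j) = 0 := by rw [hzkv, Pi.single_eq_of_ne (Ne.symm hkj)]
    have zkl : zk (a, l) = 0 := by rw [hzkv, Pi.single_eq_of_ne (Ne.symm hkl)]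
    have zll : zl (a, l) = 1 := by rw [hzlv, Pi.single_eq_same]
    have zlj : zl (a, j) = 0 := by rw [hzlv, Pi.single_eq_of_ne (Ne.symm hlj)]
    have zlk : zl (a, k) = 0 := by rw [hzlv, Pi.single_eq_of_ne hkl]
    -- off-diagonal entries of row `i` of the `z`'s vanish
    have ejl : zj (i, l) = 0 := by simpa [zjj, zjl] using Qk zj hzj
    have ejk : zj (i, k) = 0 := by simpa [zjj, zjk] using Ql zj hzj
    have ekl : zk (i, l) = 0 := by simpa [zkk, zkl] using Qj zk hzk
    have ekj : zk (i, j) = 0 := by simpa [zkj, zkk] using Ql zk hzk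
    have elk : zl (i, k) = 0 := by simpa [zlk, zll] using Qj zl hzl
    have elj : zl (i, j) = 0 := by simpa [zlj, zll] using Qk zl hzl
    -- the diagonal entries `θ_j = zj (i, j)` etc. have pairwise zero sums, hence vanish
    have sjk : zj (i, j) + zk (i, k) = 0 := by
      have h := Ql (zj + zk) (W.add_mem hzj hzk)
      simp only [Pi.add_apply, zjj, zkj, zjk, zkk, ejk, ekj, add_zero, zero_add, one_mul] at h
      linear_combination h
    have sjl : zj (i, j) + zl (i, l) = 0 := by
      have h := Qk (zj + zl) (W.add_mem hzj hzl)
      simp only [Pi.add_apply, zjj, zlj, zjl, zll, ejl, elj, add_zero, zero_add, one_mul] at h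
      linear_combination h
    have skl : zk (i, k) + zl (i, l) = 0 := by
      have h := Qj (zk + zl) (W.add_mem hzk hzl)
      simp only [Pi.add_apply, zkk, zlk, zkl, zll, ekl, elk, add_zero, zero_add, one_mul] at h
      linear_combination h
    have θl : zl (i, l) = 0 := by
      have h2 : (2 : K) * zl (i, l) = 0 := by linear_combination sjl + skl - sjk
      exact (mul_eq_zero.1 h2).resolve_left two_ne_zero
    -- polarise `Qk` at `x + z^l`
    have h := Qk (x + zl) (W.add_mem hx hzl)
    simp only [Pi.add_apply, zlj, zll, elj, θl, add_zero] at h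
    have h0 := Qk x hx
    linear_combination h - h0
  · -- COLUMN CASE
    -- `c₀ ≠ m₁`
    have hc₀m : c₀ ≠ m₁ := by
      intro hcm
      have hbot : W₀ = ⊥ := by
        rw [Submodule.eq_bot_iff]
        intro x hx
        funext p
        obtain ⟨i, j⟩ := p
        by_cases hj : j = c₀
        · rw [hj, hcm]; exact hcol x (W₀W x hx) i
        · exact hc₀ x hx i j hj
      rw [hbot, finrank_bot] at hW₀3
      exact absurd hW₀3 (by norm_num)
    -- units `E_{b c₀} ∈ W` for `b ≠ a`
    have hka : finrank K (LinearMap.ker (LinearMap.proj a : (Fin 4 → K) →ₗ[K] K)) = 3 := by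
      have hsurj : Function.Surjective (LinearMap.proj a : (Fin 4 → K) →ₗ[K] K) :=
        fun t => ⟨Pi.single a t, by simp⟩
      have h := LinearMap.finrank_range_add_finrank_ker (LinearMap.proj a : (Fin 4 → K) →ₗ[K] K)
      rw [LinearMap.range_eq_top.2 hsurj, finrank_top, Module.finrank_self,
        Module.finrank_fintype_fun_eq_card, Fintype.card_fin] at h
      omega
    have hunitc : ∀ b, b ≠ a → (Pi.single (b, c₀) (1 : K) : Fin 4 × Fin 4 → K) ∈ W := by
      intro b hba
      let γ : (Fin 4 × Fin 4 → K) →ₗ[K] (Fin 4 → K) := LinearMap.funLeft K K fun i : Fin 4 => (i, c₀)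
      have hγ : ∀ x i, γ x i = x (i, c₀) := fun _ _ => rfl
      have hker : LinearMap.ker (γ.domRestrict W₀) = ⊥ := by
        rw [Submodule.eq_bot_iff]
        intro x hx
        rw [LinearMap.mem_ker, LinearMap.domRestrict_apply] at hx
        apply Subtype.ext
        funext p
        obtain ⟨i, j⟩ := p
        change (x : Fin 4 × Fin 4 → K) (i, j) = 0
        by_cases hj : j = c₀
        · rw [hj]; have := congr_fun hx i; rwa [hγ] at this
        · exact hc₀ x x.2 i j hj
      have hrange : LinearMap.range (γ.domRestrict W₀) =
          LinearMap.ker (LinearMap.proj a : (Fin 4 → K) →ₗ[K] K) := by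
        apply Submodule.eq_of_le_of_finrank_le
        · rintro _ ⟨x, rfl⟩
          rw [LinearMap.mem_ker, LinearMap.proj_apply, LinearMap.domRestrict_apply, hγ]
          exact W₀a x x.2 c₀
        · have := LinearMap.finrank_range_add_finrank_ker (γ.domRestrict W₀)
          rw [hker, finrank_bot, add_zero] at this
          rw [hka, this, hW₀3]
      have hmem : (Pi.single b (1 : K) : Fin 4 → K) ∈ LinearMap.range (γ.domRestrict W₀) := by
        rw [hrange, LinearMap.mem_ker, LinearMap.proj_apply]
        exact Pi.single_eq_of_ne (Ne.symm hba) _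
      obtain ⟨x, hx⟩ := hmem
      have hxE : (x : Fin 4 × Fin 4 → K) = Pi.single (b, c₀) 1 := by
        funext p
        obtain ⟨i, j⟩ := p
        by_cases hj : j = c₀
        · subst hj
          have := congr_fun hx i
          rw [LinearMap.domRestrict_apply, hγ] at this
          rw [this]
          by_cases hi : i = b
          · subst hi; simp
          · rw [Pi.single_eq_of_ne hi, Pi.single_eq_of_ne (fun h => hi (Prod.mk.inj h).1)]
        · rw [hc₀ x x.2 i j hj, Pi.single_eq_of_ne (fun h => hj (Prod.mk.inj h).2)]
      rw [← hxE]
      exact W₀W x x.2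
    -- the two other columns `m', m''`
    obtain ⟨m', m'', hm'm'', hm'm, hm'c, hm''m, hm''c, hcols⟩ := exists_other_two m₁ c₀ hc₀m.symm
    -- the quadratic identities from the units `E_{c c₀}`: rows `a, d`, columns `m', m''`
    have Q : ∀ d, d ≠ a → ∀ y ∈ W, y (a, m') * y (d, m'') + y (a, m'') * y (d, m') = 0 := by
      intro d hda y hy
      obtain ⟨c, hca, hcd, -⟩ := exists_fourth a d d
      exact perm_two_of_unit W hW3 (hunitc c hca) hca.symm hcd.symm hda.symm hm'c hm''c hm'm'' hy
    -- the elements `z', z''`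
    obtain ⟨z', hz', hz'v⟩ := hunit m' hm'm
    obtain ⟨z'', hz'', hz''v⟩ := hunit m'' hm''m
    have z'1 : z' (a, m') = 1 := by rw [hz'v, Pi.single_eq_same]
    have z'0 : z' (a, m'') = 0 := by rw [hz'v, Pi.single_eq_of_ne hm'm''.symm]
    have z'c : z' (a, c₀) = 0 := by rw [hz'v, Pi.single_eq_of_ne (Ne.symm hm'c)]
    have z''1 : z'' (a, m'') = 1 := by rw [hz''v, Pi.single_eq_same]
    have z''0 : z'' (a, m') = 0 := by rw [hz''v, Pi.single_eq_of_ne hm'm'']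
    have z''c : z'' (a, c₀) = 0 := by rw [hz''v, Pi.single_eq_of_ne (Ne.symm hm''c)]
    have e' : ∀ d, d ≠ a → z' (d, m'') = 0 := fun d hda => by simpa [z'1, z'0] using Q d hda z' hz'
    have e'' : ∀ d, d ≠ a → z'' (d, m') = 0 := fun d hda => by
      simpa [z''0, z''1] using Q d hda z'' hz''
    -- the column minors kill `λ_d = z' (d, m')` and `λ''_d = z'' (d, m'')`
    have lam : ∀ (z : Fin 4 × Fin 4 → K), z ∈ W → ∀ n : Fin 4, n ≠ c₀ → z (a, c₀) = 0 →
        z (a, n) = 1 → ∀ d, d ≠ a → z (d, n) = 0 := by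
      intro z hz n hnc zac zan d hda
      obtain ⟨c, hcd, hq⟩ := exists_perm_row_vanish_of_sum_sq_swap hι W hW c₀ n d hnc.symm
      have hE : ∀ (r : Fin 4), r ≠ a → ∀ p : Fin 4 × Fin 4,
          (Pi.single (r, c₀) (1 : K) : Fin 4 × Fin 4 → K) p = if p = (r, c₀) then 1 else 0 :=
        fun r _ p => by by_cases hp : p = (r, c₀) <;> simp [hp]
      by_cases hca : c = a
      · subst hca
        -- `y = z + s E_{d c₀}`: `0 · λ_d + (z_{d c₀} + s) · 1 = 0` for `s = 0, 1`: absurd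
        exfalso
        have h0 := hq z hz
        have h1 := hq (z + Pi.single (d, c₀) 1) (W.add_mem hz (hunitc d hda))
        simp only [Pi.add_apply, hE d hda, zac, zan, if_true,
          if_neg (show (c, c₀) ≠ (d, c₀) from fun h => hcd (Prod.mk.inj h).1),
          if_neg (show (d, n) ≠ (d, c₀) from fun h => hnc (Prod.mk.inj h).2),
          if_neg (show (c, n) ≠ (d, c₀) from fun h => hcd (Prod.mk.inj h).1)] at h0 h1
        have : (1 : K) = 0 := by linear_combination h1 - h0
        exact one_ne_zero this
      · have h0 := hq z hz
        have h1 := hq (z + Pi.single (c, c₀) 1) (W.add_mem hz (hunitc c hca))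
        simp only [Pi.add_apply, hE c hca, if_true,
          if_neg (show (d, n) ≠ (c, c₀) from fun h => hcd (Prod.mk.inj h).1.symm),
          if_neg (show (d, c₀) ≠ (c, c₀) from fun h => hcd (Prod.mk.inj h).1.symm),
          if_neg (show (c, n) ≠ (c, c₀) from fun h => hnc (Prod.mk.inj h).2)] at h1
        linear_combination h1 - h0
    have lam' : ∀ d, d ≠ a → z' (d, m') = 0 := lam z' hz' m' hm'c z'c z'1
    have lam'' : ∀ d, d ≠ a → z'' (d, m'') = 0 := lam z'' hz'' m'' hm''c z''c z''1
    refine Or.inr ⟨c₀, fun x hx i j hia hjc => ?_⟩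
    rcases hcols j with hj | hj | hj | hj
    · rw [hj]; exact hcol x hx i
    · exact absurd hj hjc
    · -- `x (i, m') = 0`: polarise `Q i` at `x + z''`
      rw [hj]
      have h := Q i hia (x + z'') (W.add_mem hx hz'')
      simp only [Pi.add_apply, z''0, z''1, e'' i hia, lam'' i hia, add_zero] at h
      have h0 := Q i hia x hx
      linear_combination h - h0
    · -- `x (i, m'') = 0`: polarise `Q i` at `x + z'`
      rw [hj]
      have h := Q i hia (x + z') (W.add_mem hx hz')
      simp only [Pi.add_apply, z'1, z'0, e' i hia, lam' i hia, add_zero] at h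
      have h0 := Q i hia x hx
      linear_combination h - h0

end Summit.ValiantsHypothesis.ValiantsHypothesis.Theorems.SymPencilPerFourSixDimZeroCellSix

end
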